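import Literature.Topology.FourManifolds.ConnectedSumProofs
import Literature.Topology.FourManifolds.HomotopySpheresProofs
import Literature.Topology.FourManifolds.SmoothEmbeddingCriteria
import Literature.Topology.FourManifolds.CerfGammaFourProofs
import HarnessLib

/-!
# Transport of oriented connected sums along oriented diffeomorphisms of the summands (proofs)

Topic `Literature/Topology/FourManifolds`, a sibling proofs file of `ConnectedSum.lean` (oriented
connected sums `Literature.Topology.FourManifolds.IsOrientedConnectedSum`) on the way to Kervaire–Milnor's Theorem 1.1
(`Literature.Topology.FourManifolds.exists_commGroup_homotopySphereClass`, file `HomotopySpheres.lean`). Everything here is a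
theorem; no definition and no statement of the tree is changed.

## Content

Kervaire–Milnor, *Groups of homotopy spheres I*, Ann. of Math. 77 (1963), Lemma 2.1 (p. 505):
the connected sum is "well defined … up to orientation preserving diffeomorphism". Part of this
(the part that is pure bookkeeping, as opposed to the disc theorem of Palais and Cerf) is
*naturality in the summands*: if `(P, oP)` is an oriented connected sum `(M, oM) # (N, oN)` and
`φ : M ≅ M'` is an orientation-preserving diffeomorphism onto `(M', oM')`, then `(P, oP)` is an
oriented connected sum `(M', oM') # (N, oN)` — transport the disc `i₁` to `φ ∘ i₁` and the gluing
embedding `jA` of the punctured piece to `jA ∘ φ⁻¹|` (Kosinski, *Differential Manifolds* (1993),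
VI.1: structures are transported along diffeomorphisms). This is what reduces the class-level
facts `HomotopySphereClass.isMul_unique` / `isMul_assoc` on `Θₙ` to the manifold-level
uniqueness / associativity facts.

* `Literature.Topology.FourManifolds.IsOrientedConnectedSum.of_diffeomorph_left`, `Literature.Topology.FourManifolds.IsOrientedConnectedSum.of_diffeomorph_right`
  — the transport in either summand (same model with corners for `M`, `M'`; the right-hand
  version is deduced from the left-hand one by `IsOrientedConnectedSum.symm`).

Tools proved on the way (all folklore; Lee, *Introduction to Smooth Manifolds* (2013), Prop. 3.9:
`T_p U = T_p M` for an open submanifold `U`; Hirsch, *Differential Topology* (1976), §4.4):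

* `Literature.Topology.FourManifolds.writtenInExtChartAt_opens_eventuallyEq`, `Literature.Topology.FourManifolds.hasMFDerivAt_opens`,
  `Literature.Topology.FourManifolds.mdifferentiableAt_opens`, `Literature.Topology.FourManifolds.mfderiv_opens_eq`: a map `g : U → U'` between open
  submanifolds which is the restriction of `f : M → M'` has, in the charts of the open
  submanifolds (restrictions of the charts of `M`, `M'`), the same local representative near each
  point, hence the same `mfderiv`;
* `Literature.Topology.FourManifolds.IsOrientationPreserving.opensRestrict`: restricting an orientation-preserving differentiable
  map to open submanifolds preserves the restricted orientations (`SmoothOrientation.restrict`);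
* `Literature.Topology.FourManifolds.det_mfderiv_ne_zero_of_isSmoothEmbedding`: a `C^∞` embedding with open range between
  manifolds modelled on the same vector space has invertible differential everywhere (its inverse
  is smooth on the open range, `Literature.Topology.FourManifolds.contMDiffOn_leftInverse_of_isImmersion`, and the chain rule);
  `Literature.Topology.FourManifolds.det_mfderiv_disc_ne_zero`: the case of the disc `i₁ : E → M` of a connected sum;
* `Literature.Topology.FourManifolds.exists_diffeomorph_opens`: a diffeomorphism `φ : M ≅ M'` restricts to a diffeomorphism
  `U ≅ U'` of open submanifolds with `φ ⁻¹' U' = U`.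

## References

* M. Kervaire, J. Milnor, *Groups of homotopy spheres I*, Ann. of Math. (2) 77 (1963), 504–537,
  §2, Lemma 2.1 (p. 505). doi:10.2307/1970128 [KervaireMilnorAnnals1963]
* A. Kosinski, *Differential Manifolds*, Academic Press (1993), Ch. VI §1. [Kosinski1993]
* M. W. Hirsch, *Differential Topology*, GTM 33, Springer (1976), Ch. 4 §4. [HirschDT1976]
* J. M. Lee, *Introduction to Smooth Manifolds*, 2nd ed., GTM 218 (2013), Prop. 3.9, Prop. 4.8,
  Thm. 4.14. [LeeSmoothManifolds2013]
-/

open scoped Manifold ContDiff Topology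
open Set Module Function

noncomputable section

namespace Literature.Topology.FourManifolds

/-! ### Derivatives of restrictions to open submanifolds -/

section OpensMFDeriv

variable {E H E' H' : Type*} [NormedAddCommGroup E] [NormedSpace ℝ E] [TopologicalSpace H]
  {I : ModelWithCorners ℝ E H} [NormedAddCommGroup E'] [NormedSpace ℝ E'] [TopologicalSpace H']
  {I' : ModelWithCorners ℝ E' H'}
  {M : Type*} [TopologicalSpace M] [ChartedSpace H M]
  {M' : Type*} [TopologicalSpace M'] [ChartedSpace H' M']
  {U : TopologicalSpace.Opens M} {U' : TopologicalSpace.Opens M'} {f : M → M'} {g : U → U'}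

/-- **Local representatives on open submanifolds.** If `g : U → U'` is the restriction of
`f : M → M'` to open submanifolds (`↑(g y) = f ↑y`), then near the base point the local
representative of `g` in the preferred extended charts of `U`, `U'` at `x`, `g x` (which are the
restrictions of the charts of `M`, `M'` at `↑x`, `f ↑x`, Mathlib's `TopologicalSpace.Opens`
charted-space structure) coincides with that of `f` at `↑x` (Lee, *Introduction to Smooth
Manifolds* (2013), Prop. 3.9 and Example 1.26: open submanifolds). [folklore] -/
theorem writtenInExtChartAt_opens_eventuallyEq (hfg : ∀ y, (g y : M') = f y) (x : U) :
    writtenInExtChartAt I I' x g =ᶠ[𝓝 ((extChartAt I x) x)]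
      writtenInExtChartAt I I' (x : M) f := by
  have h1 := TopologicalSpace.Opens.chartAt_subtype_val_symm_eventuallyEq (H := H) U (x := x)
  have h2 : ContinuousAt I.symm ((extChartAt I x) x) := I.continuous_symm.continuousAt
  have h3 : I.symm ((extChartAt I x) x) = chartAt H (x : M) x := by
    simp only [extChartAt_coe, Function.comp_apply, ModelWithCorners.left_inv]
    rfl
  rw [ContinuousAt, h3] at h2
  filter_upwards [h2.eventually h1] with z hz
  simp only [writtenInExtChartAt, Function.comp_apply, extChartAt_coe, extChartAt_coe_symm,
    TopologicalSpace.Opens.chartAt_eq, OpenPartialHomeomorph.subtypeRestr_coe, restrict_apply]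
  simp only [Function.comp_apply, TopologicalSpace.Opens.chartAt_eq] at hz
  simp only [hfg]
  rw [← hz]

/-- A restriction `g : U → U'` of `f : M → M'` to open submanifolds has at `x` every manifold
derivative that `f` has at `↑x` (same local representatives near the base point,
`writtenInExtChartAt_opens_eventuallyEq`; Lee (2013), Prop. 3.9: `T_p U = T_p M`). [folklore] -/
theorem hasMFDerivAt_opens (hfg : ∀ y, (g y : M') = f y) {x : U} {f' : E →L[ℝ] E'}
    (hf : HasMFDerivAt I I' f (x : M) f') : HasMFDerivAt I I' g x f' := by
  refine ⟨?_, ?_⟩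
  · rw [Topology.IsInducing.subtypeVal.continuousAt_iff]
    exact (hf.1.comp continuous_subtype_val.continuousAt).congr_of_eventuallyEq
      (Filter.Eventually.of_forall hfg)
  · have heq := writtenInExtChartAt_opens_eventuallyEq (I := I) (I' := I') hfg x
    exact hf.2.congr_of_eventuallyEq (heq.filter_mono nhdsWithin_le_nhds) heq.eq_of_nhds

/-- A restriction `g : U → U'` of `f : M → M'` to open submanifolds is differentiable at `x` if
`f` is differentiable at `↑x` (Lee (2013), Prop. 3.9). [folklore] -/
theorem mdifferentiableAt_opens (hfg : ∀ y, (g y : M') = f y) {x : U}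
    (hf : MDifferentiableAt I I' f (x : M)) : MDifferentiableAt I I' g x :=
  (hasMFDerivAt_opens hfg hf.hasMFDerivAt).mdifferentiableAt

/-- **`T_p U = T_p M`, in coordinates.** The manifold derivative at `x` of a restriction
`g : U → U'` of `f : M → M'` to open submanifolds equals the manifold derivative of `f` at `↑x`
(as continuous linear maps `E →L[ℝ] E'`; `f` differentiable at `↑x`). Lee, *Introduction to Smooth
Manifolds* (2013), Prop. 3.9. [folklore] -/
theorem mfderiv_opens_eq (hfg : ∀ y, (g y : M') = f y) {x : U}
    (hf : MDifferentiableAt I I' f (x : M)) :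
    mfderiv I I' g x = mfderiv I I' f (x : M) :=
  (hasMFDerivAt_opens hfg hf.hasMFDerivAt).mfderiv

end OpensMFDeriv

/-! ### Restricting orientation-preserving maps to open submanifolds -/

section OrientationRestrict

variable {E H H' : Type*} [NormedAddCommGroup E] [NormedSpace ℝ E] [TopologicalSpace H]
  [TopologicalSpace H'] {I : ModelWithCorners ℝ E H} {I' : ModelWithCorners ℝ E H'}
  {M : Type*} [TopologicalSpace M] [ChartedSpace H M] [IsManifold I 1 M]
  {M' : Type*} [TopologicalSpace M'] [ChartedSpace H' M'] [IsManifold I' 1 M']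
  {U : TopologicalSpace.Opens M} {U' : TopologicalSpace.Opens M'}

omit [IsManifold I 1 M] [IsManifold I' 1 M'] in
/-- The Jacobian determinant of a restriction `g : U → U'` of `f : M → M'` to open submanifolds
(same model vector space `E`) at `x` is that of `f` at `↑x` (`mfderiv_opens_eq`; Hirsch,
*Differential Topology* (1976), §4.4). [folklore] -/
theorem det_mfderiv_opens_eq {f : M → M'} {g : U → U'} (hfg : ∀ y, (g y : M') = f y) {x : U}
    (hf : MDifferentiableAt I I' f (x : M)) :
    LinearMap.det (M := E) (mfderiv I I' g x).toLinearMap =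
      LinearMap.det (M := E) (mfderiv I I' f (x : M)).toLinearMap :=
  congrArg (fun A : E →L[ℝ] E => LinearMap.det (A : E →ₗ[ℝ] E)) (mfderiv_opens_eq hfg hf)

/-- **Restriction of orientation-preserving maps to open submanifolds.** If the differentiable
map `f : M → M'` preserves the orientations `oM`, `oM'`, then its restriction `g : U → U'` to open
submanifolds preserves the restricted orientations `oM.restrict U`, `oM'.restrict U'`: orientations
and Jacobians of the open submanifolds are those of the ambient manifolds
(`SmoothOrientation.restrict_apply`, `det_mfderiv_opens_eq`). Hirsch, *Differential Topology*
(1976), §4.4 (an open subset of an oriented manifold is canonically oriented). [folklore] -/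
theorem IsOrientationPreserving.opensRestrict {oM : SmoothOrientation I M}
    {oM' : SmoothOrientation I' M'} {f : M → M'} (hf : IsOrientationPreserving oM oM' f)
    (hfd : MDifferentiable I I' f) {g : U → U'} (hfg : ∀ y, (g y : M') = f y) :
    IsOrientationPreserving (oM.restrict U) (oM'.restrict U') g := by
  intro x
  rw [det_mfderiv_opens_eq hfg (hfd _), SmoothOrientation.restrict_apply,
    SmoothOrientation.restrict_apply, hfg x]
  exact hf x

end OrientationRestrict

/-! ### Open smooth embeddings have invertible differentials -/

section DetEmbedding

variable {E HA HP : Type*} [NormedAddCommGroup E] [NormedSpace ℝ E] [TopologicalSpace HA]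
  [TopologicalSpace HP] {IA : ModelWithCorners ℝ E HA} {IP : ModelWithCorners ℝ E HP}
  {A : Type*} [TopologicalSpace A] [ChartedSpace HA A]
  {P : Type*} [TopologicalSpace P] [ChartedSpace HP P]

/-- **An open smooth embedding has invertible differential.** If `f : A → P` is a `C^∞` embedding
with open range between manifolds modelled on the same vector space `E`, then
`det (mfderiv f x) ≠ 0` for every `x`: a left inverse `g` of `f` is `C^∞` on the open set
`range f` (`Literature.Topology.FourManifolds.contMDiffOn_leftInverse_of_isImmersion`), and the chain rule applied to
`g ∘ f = id` gives `det (dg) · det (df) = 1` (Lee, *Introduction to Smooth Manifolds* (2013),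
Prop. 4.8 (b) and Thm. 4.14: an open smooth embedding is a diffeomorphism onto its image, in
particular a local diffeomorphism). [folklore] -/
theorem det_mfderiv_ne_zero_of_isSmoothEmbedding {f : A → P}
    (hf : Manifold.IsSmoothEmbedding IA IP ∞ f) (ho : IsOpen (range f)) (x : A) :
    LinearMap.det (M := E) (mfderiv IA IP f x).toLinearMap ≠ 0 := by
  haveI : Nonempty A := ⟨x⟩
  set g : P → A := Function.invFun f with hg_def
  have hg : LeftInverse g f := leftInverse_invFun hf.isEmbedding.injective
  have hgs : ContMDiffOn IP IA ∞ g (range f) :=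
    contMDiffOn_leftInverse_of_isImmersion hf.isImmersion hf.isEmbedding hg
  have hgd : MDifferentiableAt IP IA g (f x) :=
    (hgs.contMDiffAt (ho.mem_nhds (mem_range_self x))).mdifferentiableAt (by simp)
  have hfd : MDifferentiableAt IA IP f x := (hf.contMDiff x).mdifferentiableAt (by simp)
  have hchain : mfderiv IA IA (g ∘ f) x = (mfderiv IP IA g (f x)).comp (mfderiv IA IP f x) :=
    mfderiv_comp x hgd hfd
  have hid : g ∘ f = id := funext hg
  rw [hid, mfderiv_id] at hchain
  exact right_ne_zero_of_mul_eq_one (det_mul_det_eq_one_of_comp_eq_id (E := E) hchain.symm)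

variable [T2Space A] in
/-- **The disc of a connected sum has invertible differential.** If `i : E → A` is a `C^∞`
embedding of the model vector space and some map `j` on the punctured piece `A ∖ {i 0}` is a
`C^∞` immersion into a manifold `P` modelled on `E` (the data of `Literature.Topology.FourManifolds.IsConnectedSum`), then
`det (mfderiv i v) ≠ 0` for all `v`: either `finrank ℝ E = 0` and every determinant is `1`, or
`i` is an open embedding by the dimension count of
`Literature.Topology.FourManifolds.isOpenEmbedding_of_isSmoothEmbedding_of_isImmersion` and
`det_mfderiv_ne_zero_of_isSmoothEmbedding` applies (Kosinski, *Differential Manifolds* (1993),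
VI.1: the discs of a connected sum are equidimensional embeddings). [folklore] -/
theorem det_mfderiv_disc_ne_zero {i : E → A} (hi : Manifold.IsSmoothEmbedding 𝓘(ℝ, E) IA ∞ i)
    {j : puncture i → P} (hj : Manifold.IsImmersion IA IP ∞ j) (v : E) :
    LinearMap.det (M := E) (mfderiv 𝓘(ℝ, E) IA i v).toLinearMap ≠ 0 := by
  rcases Nat.eq_zero_or_pos (finrank ℝ E) with h0 | hpos
  · exact ne_of_eq_of_ne
      (LinearMap.det_eq_one_of_finrank_eq_zero h0 (mfderiv 𝓘(ℝ, E) IA i v).toLinearMap)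
      one_ne_zero
  · haveI : Nontrivial E := Module.nontrivial_of_finrank_pos (R := ℝ) hpos
    obtain ⟨u, hu⟩ := exists_ne (0 : E)
    haveI : Nonempty (puncture i) := ⟨⟨i u, fun h => hu (hi.isEmbedding.injective h)⟩⟩
    exact det_mfderiv_ne_zero_of_isSmoothEmbedding hi
      (isOpenEmbedding_of_isSmoothEmbedding_of_isImmersion hpos hi hj).isOpen_range v

end DetEmbedding

/-! ### Restricting a diffeomorphism to open submanifolds -/

section OpensDiffeo

variable {E H H' : Type*} [NormedAddCommGroup E] [NormedSpace ℝ E] [TopologicalSpace H]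
  [TopologicalSpace H'] {I : ModelWithCorners ℝ E H} {I' : ModelWithCorners ℝ E H'}
  {M : Type*} [TopologicalSpace M] [ChartedSpace H M]
  {M' : Type*} [TopologicalSpace M'] [ChartedSpace H' M']

/-- **Restriction of a diffeomorphism to open submanifolds.** A diffeomorphism `φ : M ≅ M'`
restricts to a diffeomorphism `ψ : U ≅ U'` (`↑(ψ x) = φ ↑x`) between open submanifolds `U ⊆ M`,
`U' ⊆ M'` with `φ ⁻¹' U' = U`; smoothness of the (co)restrictions is Mathlib's
`ContMDiff.subtypeVal_comp_iff` / `contMDiff_subtype_val` (Lee, *Introduction to Smooth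
Manifolds* (2013), Thm. 4.14 ff.; Kosinski (1993), VI.1). Stated as an existence theorem (no new
definition in this proofs file). [folklore] -/
theorem exists_diffeomorph_opens (φ : M ≃ₘ⟮I, I'⟯ M') (U : TopologicalSpace.Opens M)
    (U' : TopologicalSpace.Opens M') (hU : ∀ x, φ x ∈ U' ↔ x ∈ U) :
    ∃ ψ : U ≃ₘ⟮I, I'⟯ U', ∀ x, (ψ x : M') = φ x := by
  have hU' : ∀ y, φ.symm y ∈ U ↔ y ∈ U' := fun y => by rw [← hU, φ.apply_symm_apply]
  refine ⟨{ toFun := fun x => ⟨φ x, (hU x).2 x.2⟩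
            invFun := fun y => ⟨φ.symm y, (hU' y).2 y.2⟩
            left_inv := fun x => Subtype.ext (φ.symm_apply_apply x)
            right_inv := fun y => Subtype.ext (φ.apply_symm_apply y)
            contMDiff_toFun := ?_
            contMDiff_invFun := ?_ }, fun x => rfl⟩
  · exact (ContMDiff.subtypeVal_comp_iff U' _).1 (φ.contMDiff.comp contMDiff_subtype_val)
  · exact (ContMDiff.subtypeVal_comp_iff U _).1 (φ.symm.contMDiff.comp contMDiff_subtype_val)

end OpensDiffeo

/-! ### Transport of oriented connected sums along oriented diffeomorphisms of a summand -/

section Transport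

variable {E HM HN HP : Type*} [NormedAddCommGroup E] [NormedSpace ℝ E]
  [TopologicalSpace HM] {IM : ModelWithCorners ℝ E HM}
  [TopologicalSpace HN] {IN : ModelWithCorners ℝ E HN}
  [TopologicalSpace HP] {IP : ModelWithCorners ℝ E HP}
  {M M' N N' P : Type*}
  [TopologicalSpace M] [T2Space M] [ChartedSpace HM M] [IsManifold IM ∞ M]
  [TopologicalSpace M'] [T2Space M'] [ChartedSpace HM M'] [IsManifold IM ∞ M']
  [TopologicalSpace N] [T2Space N] [ChartedSpace HN N] [IsManifold IN ∞ N]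
  [TopologicalSpace N'] [T2Space N'] [ChartedSpace HN N'] [IsManifold IN ∞ N']
  [TopologicalSpace P] [ChartedSpace HP P] [IsManifold IP ∞ P]

/-- **Naturality of the oriented connected sum in the first summand** (Kervaire–Milnor, *Groups
of homotopy spheres I* (1963), Lemma 2.1, p. 505: the connected sum is "well defined … up to
orientation preserving diffeomorphism"; Kosinski, *Differential Manifolds* (1993), VI.1). If
`(P, oP)` is an oriented connected sum `(M, oM) # (N, oN)` and `φ : M ≅ M'` is an
orientation-preserving diffeomorphism onto `(M', oM')` (same model with corners), then `(P, oP)`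
is an oriented connected sum `(M', oM') # (N, oN)`. Proof: replace the disc `i₁` by `φ ∘ i₁`
(orientation preserving by the chain rule, `IsOrientationPreserving.comp_holds`, the differentials
of `φ` and of the disc being invertible, `det_mfderiv_disc_ne_zero`) and the gluing embedding
`jA` of `M ∖ {i₁ 0}` by `jA ∘ ψ`, where `ψ : M' ∖ {φ (i₁ 0)} ≅ M ∖ {i₁ 0}` is the restriction of
`φ⁻¹` (`exists_diffeomorph_opens`; orientation preserving for the restricted orientations by
`IsOrientationPreserving.opensRestrict`, so that `jA ∘ ψ` is orientation preserving by the chain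
rule, `jA` having invertible differential as an open embedding,
`det_mfderiv_ne_zero_of_isSmoothEmbedding`); the gluing relation is unchanged since
`φ⁻¹ a = i₁ (t • u) ↔ a = φ (i₁ (t • u))`. [cite: KervaireMilnorAnnals1963, Lemma 2.1 (p. 505)] -/
theorem IsOrientedConnectedSum.of_diffeomorph_left {oM : SmoothOrientation IM M}
    {oM' : SmoothOrientation IM M'} {oN : SmoothOrientation IN N} {oP : SmoothOrientation IP P}
    (h : IsOrientedConnectedSum oM oN oP) (φ : M ≃ₘ⟮IM, IM⟯ M')
    (hφ : φ.IsOrientationPreserving oM oM') : IsOrientedConnectedSum oM' oN oP := by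
  obtain ⟨i₁, i₂, o₀, jA, jB, h₁, h₂, ho₁, ho₂, ⟨hA, hAo, hB, hBo, hU, hR⟩, hjA, hjB⟩ := h
  have hinf : (∞ : ℕ∞ω) ≠ 0 := by simp
  -- the transported disc
  have h₁' : Manifold.IsSmoothEmbedding 𝓘(ℝ, E) IM ∞ (φ ∘ i₁) := h₁.diffeomorph_comp φ
  -- the restriction `ψ` of `φ⁻¹` to the punctured pieces
  have key : ∀ (y : M') (m : M), φ.symm y = m ↔ y = φ m := fun y m => by
    constructor
    · rintro rfl
      exact (φ.apply_symm_apply y).symm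
    · rintro rfl
      exact φ.symm_apply_apply m
  obtain ⟨ψ, hψ⟩ := exists_diffeomorph_opens φ.symm (puncture (φ ∘ i₁)) (puncture i₁)
    (fun y => by
      rw [mem_puncture, mem_puncture, Function.comp_apply]
      exact (key y (i₁ 0)).not)
  -- differentiability and Jacobians
  have hφd : MDifferentiable IM IM φ := φ.mdifferentiable hinf
  have hφsd : MDifferentiable IM IM φ.symm := φ.symm.mdifferentiable hinf
  have hψd : MDifferentiable IM IM ψ := ψ.mdifferentiable hinf
  have h₁d : MDifferentiable 𝓘(ℝ, E) IM i₁ := h₁.contMDiff.mdifferentiable hinf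
  have hAd : MDifferentiable IM IP jA := hA.contMDiff.mdifferentiable hinf
  have hdet₁ : ∀ v, LinearMap.det (M := E) (mfderiv 𝓘(ℝ, E) IM i₁ v).toLinearMap ≠ 0 :=
    det_mfderiv_disc_ne_zero h₁ hA.isImmersion
  have hdetA : ∀ a, LinearMap.det (M := E) (mfderiv IM IP jA a).toLinearMap ≠ 0 :=
    det_mfderiv_ne_zero_of_isSmoothEmbedding hA hAo
  -- the transported disc preserves orientation
  have ho₁' : IsOrientationPreserving (SmoothOrientation.modelSpace o₀) oM' (φ ∘ i₁) :=
    IsOrientationPreserving.comp_holds hφ ho₁ hφd h₁d (φ.det_mfderiv_ne_zero hinf) hdet₁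
  -- `ψ` preserves the restricted orientations, hence so does `jA ∘ ψ`
  have hψo : IsOrientationPreserving (oM'.restrict (puncture (φ ∘ i₁)))
      (oM.restrict (puncture i₁)) ψ :=
    IsOrientationPreserving.opensRestrict
      (Diffeomorph.IsOrientationPreserving.symm_holds hφ hinf) hφsd hψ
  have hjA' : IsOrientationPreserving (oM'.restrict (puncture (φ ∘ i₁))) oP (jA ∘ ψ) :=
    IsOrientationPreserving.comp_holds hjA hψo hAd hψd hdetA (ψ.det_mfderiv_ne_zero hinf)
  have hψs : Function.Surjective ψ := ψ.surjective
  refine ⟨φ ∘ i₁, i₂, o₀, jA ∘ ψ, jB, h₁', h₂, ho₁', ho₂,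
    ⟨hA.comp_diffeomorph ψ, ?_, hB, hBo, ?_, fun a b => ?_⟩, hjA', hjB⟩
  · rw [hψs.range_comp]
    exact hAo
  · rw [hψs.range_comp]
    exact hU
  · rw [Function.comp_apply, hR (ψ a) b]
    simp only [connectedSumRel, Function.comp_apply, hψ, key]

/-- **Naturality of the oriented connected sum in the second summand** (Kervaire–Milnor 1963,
Lemma 2.1, p. 505; Kosinski (1993), VI.1): if `(P, oP)` is an oriented connected sum
`(M, oM) # (N, oN)` and `φ : N ≅ N'` is an orientation-preserving diffeomorphism onto `(N', oN')`,
then `(P, oP)` is an oriented connected sum `(M, oM) # (N', oN')`. From the first-summand version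
by the symmetry `(M, oM) # (N, oN) = (N, oN) # (M, oM)` of the relation
(`IsOrientedConnectedSum.symm`). [cite: KervaireMilnorAnnals1963, Lemma 2.1 (p. 505)] -/
theorem IsOrientedConnectedSum.of_diffeomorph_right {oM : SmoothOrientation IM M}
    {oN : SmoothOrientation IN N} {oN' : SmoothOrientation IN N'} {oP : SmoothOrientation IP P}
    (h : IsOrientedConnectedSum oM oN oP) (φ : N ≃ₘ⟮IN, IN⟯ N')
    (hφ : φ.IsOrientationPreserving oN oN') : IsOrientedConnectedSum oM oN' oP :=
  (h.symm.of_diffeomorph_left φ hφ).symm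

/-- **Naturality of the oriented connected sum in both summands** (Kervaire–Milnor 1963,
Lemma 2.1, p. 505): an oriented connected sum `(M, oM) # (N, oN)` is an oriented connected sum
`(M', oM') # (N', oN')` for any orientation-preserving diffeomorphisms `M ≅ M'`, `N ≅ N'`.
[cite: KervaireMilnorAnnals1963, Lemma 2.1 (p. 505)] -/
theorem IsOrientedConnectedSum.of_diffeomorph {oM : SmoothOrientation IM M}
    {oM' : SmoothOrientation IM M'} {oN : SmoothOrientation IN N} {oN' : SmoothOrientation IN N'}
    {oP : SmoothOrientation IP P} (h : IsOrientedConnectedSum oM oN oP) (φ : M ≃ₘ⟮IM, IM⟯ M')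
    (hφ : φ.IsOrientationPreserving oM oM') (χ : N ≃ₘ⟮IN, IN⟯ N')
    (hχ : χ.IsOrientationPreserving oN oN') : IsOrientedConnectedSum oM' oN' oP :=
  (h.of_diffeomorph_left φ hφ).of_diffeomorph_right χ hχ

end Transport

end Literature.Topology.FourManifolds
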